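import Mathlib
import HarnessLib
import Summits.Ventures.LatticeQCDFlow.Exactness.CabibboMarinariORSweep
import Summits.Ventures.LatticeQCDFlow.Exactness.OpenBoundaryWilsonAction
import Summits.Ventures.LatticeQCDFlow.Exactness.TransformedKernel
import Summits.Ventures.LatticeQCDFlow.Scoring.SymmetricSamplerOddObservables
import Literature.Barriers.QuantumFields.CenterSymmetryBreakingByQuarks

/-!
# Arm E1 is centre symmetric: the Cabibbo–Marinari heat-bath sweep and every over-relaxation sweep commute with the global centre transformation — `⟨tr P⟩ = 0` at EVERY sweep of a hot-started `SU(N)` run (periodic or open boundary)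

HONEST FRAMING: exact (Metropolis-corrected) sampling algorithms for lattice gauge theory;
figures of merit are autocorrelation/cost numbers at stated couplings and volumes; no
continuum-physics claim.

Venture `LatticeQCDFlow` (cell pub-lqcd), topic `Exactness`, FANOUT row 21 (`su3-base`, arm E1 = `'hb' + n_or × 'or'`, and the
open-boundary heat-bath sweep of `OpenBoundaryCMSweep`).  NEW WORK of the cell.  Row 16 recorded that the fixed lexicographic E1 sweep
is NOT `Θ'`-symmetric as an ordered product, and row 21's `StapleSumLatticeSymmetry` that axis permutations / translations only RELABEL
its schedule; under the Literature's global CENTRE transformation `centerTwist z t₀` (`U₀(x⃗,t₀) ↦ z U₀(x⃗,t₀)` on one time slice, `z`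
central; `Literature/Barriers/QuantumFields/CenterSymmetryBreakingByQuarks`, whose `wilsonExpectation_tracePolyakov_eq_zero` is the
EQUILIBRIUM statement) the E1 sweep IS exactly symmetric, schedule and all.  Over the cell's E1 kernels (`CabibboMarinariORSweep`:
`latStaple`, `cmLatOR`, `cmORSweep`; `CabibboMarinariLatticeErgodic`: `latHit`, `latLink`, `latSweep`; `CabibboMarinariOverrelax`:
`cmQuat`, `cmUnit`, `cmOR`; `SubgroupHeatBath`), row 7's `TransformedKernel` (`conjKernel`) and row 16's
`Scoring/SymmetricSamplerOddObservables` (`map_bind_nHit_eq_self`).  Nothing is cited as a fact; no number.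

## What is proved (every `d ≥ 1`, `L ≥ 1`, `N`, `β`, central `z`, slice `t₀`, every subgroup frame, link order and schedule)

* §1 `stapleUp/Down_centerTwist`, `stapleSum_centerTwist`, `latStaple_centerTwist` — staples pick up the inverse twist factor
  `c_l⁻¹` of their OWN link (`c_l = twistConfig z t₀ l`; plaquettes are centre-blind).
* §2 `coe_mul_latStaple_centerTwist` (`U_l R_l` is twist invariant) ⇒ `cmQuat/cmUnit/cmOR_centerTwist` (`OR(zU)_l = c_l · OR(U)_l`),
  **`conjKernel_cmLatOR_centerTwist`**, **`conjKernel_cmORSweep_centerTwist`** — every OR sweep, in its given order, commutes.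
* §3 `conjKernel_latHit/latLink/latSweep_mulLeft_central` — the Cabibbo–Marinari hit / link update / sweep commute with left
  multiplication by ANY central-valued configuration preserving the weight.
* §4 **`conjKernel_cmHeatBath_orSweep_centerTwist`** (row 21's E1 composite, Wilson weight),
  `integral_e1Chain_eq_zero_of_centerCovariant` (twist-invariant starts stay so: `map_bind_nHit_eq_self`), **`integral_e1HotStart_tracePolyakov_eq_zero`** — `SU(N)`, `N ≥ 2`: the traced
  fundamental Polyakov loop has `E_n[tr P(y)] = 0` AT EVERY SWEEP `n` of a HOT-started E1 run (cold start: not twist invariant, no twin).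
* §5 **`conjKernel_obcSweep_centerTwist`**, **`integral_obcSweepHotStart_tracePolyakov_eq_zero`** — the same for the open-boundary
  heat-bath sweep `latSweep (gibbsDensity (β S_OBC))` of every open direction `τ`.

NOT CLAIMED: stationarity (rows 7/9); `|P|`, correlators, susceptibility; floating point; numbers.
-/


noncomputable section

open MeasureTheory ProbabilityTheory Function
open scoped ENNReal
open Literature.MathematicalPhysics.QuantumFieldTheory
open Literature.Barriers.QuantumFields (twistConfig centerTwist centerTwist_apply twistConfig_mem_center
  plaquetteHolonomy_centerTwist wilsonAction_centerTwist centerTwistEquiv centerTwistEquiv_apply map_centerTwist_pi_haar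
  integral_eq_zero_of_covariant tracePolyakov isCenterCovariant_tracePolyakov)

namespace Summit.Ventures.LatticeQCDFlow.Exactness

/-! ## §1 Staples pick up the inverse twist factor of their own link -/

section Staples

variable {d L N : ℕ} [NeZero d] {G : Type*} [Group G] {z : G} (hz : z ∈ Subgroup.center G) (t₀ : ZMod L)
include hz

omit hz in
/-- The twisted link: `(zU)_l = c_l · U_l`. -/
theorem centerTwist_apply_eq (z : G) (U : GaugeConfig d L G) (l : Edge d L) : centerTwist z t₀ U l = twistConfig z t₀ l * U l :=
  rfl

omit hz in
/-- Central factors commute with everything: `g · c_l⁻¹ = c_l⁻¹ · g`. -/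
theorem mul_twistConfig_inv_comm (hz : z ∈ Subgroup.center G) (l : Edge d L) (g : G) :
    g * (twistConfig z t₀ l)⁻¹ = (twistConfig z t₀ l)⁻¹ * g :=
  Subgroup.mem_center_iff.1 (Subgroup.inv_mem _ (twistConfig_mem_center (d := d) (L := L) hz t₀ l)) g

/-- **Upper staples: `A_ν(zU) = c_l⁻¹ · A_ν(U)`** (the plaquette `U_l A_ν` is centre-blind). -/
theorem stapleUp_centerTwist (U : GaugeConfig d L G) (x : Site d L) (μ ν : Fin d) :
    Scoring.stapleUp (centerTwist z t₀ U) x μ ν = (twistConfig z t₀ (x, μ))⁻¹ * Scoring.stapleUp U x μ ν := by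
  have h1 := Scoring.plaquetteHolonomy_eq_mul_stapleUp (centerTwist z t₀ U) x μ ν
  rw [plaquetteHolonomy_centerTwist hz, Scoring.plaquetteHolonomy_eq_mul_stapleUp] at h1
  rw [eq_inv_mul_of_mul_eq (b := twistConfig z t₀ (x, μ) * U (x, μ)) h1.symm, _root_.mul_inv_rev, mul_twistConfig_inv_comm t₀ hz, mul_assoc, inv_mul_cancel_left]

/-- Conjugating by a twisted link is conjugating by the untwisted one. -/
theorem inv_mul_mul_centerTwist_eq (U : GaugeConfig d L G) (e : Edge d L) (H : G) :
    (centerTwist z t₀ U e)⁻¹ * H * centerTwist z t₀ U e = (U e)⁻¹ * H * U e := by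
  have hc := Subgroup.mem_center_iff.1 (twistConfig_mem_center (d := d) (L := L) hz t₀ e)
  have key : (twistConfig z t₀ e)⁻¹ * (H * twistConfig z t₀ e) = H := by rw [hc H, ← mul_assoc, inv_mul_cancel, one_mul]
  rw [centerTwist_apply_eq]
  calc (twistConfig z t₀ e * U e)⁻¹ * H * (twistConfig z t₀ e * U e)
      = (U e)⁻¹ * ((twistConfig z t₀ e)⁻¹ * (H * twistConfig z t₀ e)) * U e := by
        rw [_root_.mul_inv_rev]; simp only [mul_assoc]
    _ = (U e)⁻¹ * H * U e := by rw [key]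

/-- **Lower staples: `B_ν(zU) = c_l⁻¹ · B_ν(U)`** (the lower plaquette read from `x` is centre-blind). -/
theorem stapleDown_centerTwist (U : GaugeConfig d L G) (x : Site d L) (μ ν : Fin d) :
    Scoring.stapleDown (centerTwist z t₀ U) x μ ν = (twistConfig z t₀ (x, μ))⁻¹ * Scoring.stapleDown U x μ ν := by
  have h1 := Scoring.conj_plaquetteHolonomy_eq_mul_stapleDown (centerTwist z t₀ U) x μ ν
  rw [plaquetteHolonomy_centerTwist hz, inv_mul_mul_centerTwist_eq hz, Scoring.conj_plaquetteHolonomy_eq_mul_stapleDown] at h1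
  rw [eq_inv_mul_of_mul_eq (b := twistConfig z t₀ (x, μ) * U (x, μ)) h1.symm, _root_.mul_inv_rev, mul_twistConfig_inv_comm t₀ hz, mul_assoc, inv_mul_cancel_left]

/-- **The staple sum: `R_l(zU) = ρ(c_l⁻¹) · R_l(U)`.** -/
theorem stapleSum_centerTwist (ρ : G →* Matrix (Fin N) (Fin N) ℂ) (U : GaugeConfig d L G) (x : Site d L) (μ : Fin d) :
    Scoring.stapleSum ρ (centerTwist z t₀ U) x μ = ρ ((twistConfig z t₀ (x, μ))⁻¹) * Scoring.stapleSum ρ U x μ := by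
  rw [Scoring.stapleSum_def, Scoring.stapleSum_def, Finset.mul_sum]
  refine Finset.sum_congr rfl fun ν _ => ?_
  rw [stapleUp_centerTwist hz, stapleDown_centerTwist hz, map_mul, map_mul, Matrix.mul_add]

end Staples

/-! ## §2 The over-relaxation hit and sweep commute with the twist (same link, same frame, same order) -/

section OverRelax

variable {d L N : ℕ} [NeZero d] {m : Type*} [Fintype m] [DecidableEq m]
  {z : Matrix.specialUnitaryGroup (Fin N) ℂ} (hz : z ∈ Subgroup.center (Matrix.specialUnitaryGroup (Fin N) ℂ)) (t₀ : ZMod L)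
include hz

/-- The engine's staple function under the twist. -/
theorem latStaple_centerTwist (U : GaugeConfig d L (Matrix.specialUnitaryGroup (Fin N) ℂ)) (l : Edge d L) :
    latStaple (centerTwist z t₀ U) l =
      (((twistConfig z t₀ l)⁻¹ : Matrix.specialUnitaryGroup (Fin N) ℂ) : Matrix (Fin N) (Fin N) ℂ) * latStaple U l :=
  stapleSum_centerTwist hz t₀ (suRep N) U l.1 l.2

/-- **The product `U_l R_l` — all the local algorithms see — is twist invariant.** -/
theorem coe_mul_latStaple_centerTwist (U : GaugeConfig d L (Matrix.specialUnitaryGroup (Fin N) ℂ)) (l : Edge d L) :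
    ((centerTwist z t₀ U l : Matrix.specialUnitaryGroup (Fin N) ℂ) : Matrix (Fin N) (Fin N) ℂ) * latStaple (centerTwist z t₀ U) l =
      ((U l : Matrix.specialUnitaryGroup (Fin N) ℂ) : Matrix (Fin N) (Fin N) ℂ) * latStaple U l := by
  have hcomm : U l * (twistConfig z t₀ l)⁻¹ = (twistConfig z t₀ l)⁻¹ * U l := mul_twistConfig_inv_comm t₀ hz l (U l)
  rw [latStaple_centerTwist hz, centerTwist_apply_eq, ← Matrix.mul_assoc, ← Submonoid.coe_mul, mul_assoc, hcomm, ← mul_assoc,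
    mul_inv_cancel, one_mul]

omit [Fintype m] [DecidableEq m] in
/-- The subgroup data of the OR / heat-bath hit is twist invariant. -/
theorem cmQuat_centerTwist (e : Fin N ≃ Fin 2 ⊕ m) (U : GaugeConfig d L (Matrix.specialUnitaryGroup (Fin N) ℂ)) (l : Edge d L) :
    cmQuat e (latStaple (centerTwist z t₀ U) l) (centerTwist z t₀ U l) = cmQuat e (latStaple U l) (U l) := by
  unfold cmQuat
  rw [coe_mul_latStaple_centerTwist hz]

omit [Fintype m] [DecidableEq m] in
/-- The OR subgroup unit is twist invariant. -/
theorem cmUnit_centerTwist (e : Fin N ≃ Fin 2 ⊕ m) (U : GaugeConfig d L (Matrix.specialUnitaryGroup (Fin N) ℂ)) (l : Edge d L) :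
    cmUnit e (latStaple (centerTwist z t₀ U) l) (centerTwist z t₀ U l) = cmUnit e (latStaple U l) (U l) :=
  Subtype.ext (by rw [coe_cmUnit, coe_cmUnit, cmQuat_centerTwist hz])

/-- **The engine's OR hit commutes with the twist**: `OR(zU)_l = c_l · OR(U)_l`. -/
theorem cmOR_centerTwist (e : Fin N ≃ Fin 2 ⊕ m) (U : GaugeConfig d L (Matrix.specialUnitaryGroup (Fin N) ℂ)) (l : Edge d L) :
    cmOR e (latStaple (centerTwist z t₀ U) l) (centerTwist z t₀ U l) = twistConfig z t₀ l * cmOR e (latStaple U l) (U l) := by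
  have hc := Subgroup.mem_center_iff.1 (twistConfig_mem_center (d := d) (L := L) hz t₀ l)
  rw [cmOR, cmOR, cmUnit_centerTwist hz, centerTwist_apply_eq, ← mul_assoc, hc, mul_assoc]

/-- The site update of the OR hit commutes with the twist. -/
theorem siteUpdateMap_cmOR_centerTwist (e : Fin N ≃ Fin 2 ⊕ m) (l : Edge d L)
    (U : GaugeConfig d L (Matrix.specialUnitaryGroup (Fin N) ℂ)) :
    siteUpdateMap (X := fun _ : Edge d L => Matrix.specialUnitaryGroup (Fin N) ℂ) l (fun V g => cmOR e (latStaple V l) g)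
        (centerTwist z t₀ U) =
      centerTwist z t₀ (siteUpdateMap (X := fun _ : Edge d L => Matrix.specialUnitaryGroup (Fin N) ℂ) l
        (fun V g => cmOR e (latStaple V l) g) U) := by
  funext e'
  simp only [siteUpdateMap]
  by_cases h : e' = l
  · subst h
    rw [update_self, cmOR_centerTwist hz, centerTwist_apply_eq, update_self]
  · rw [update_of_ne h, centerTwist_apply_eq, centerTwist_apply_eq, update_of_ne h]

variable [NeZero L]

/-- **The OR hit kernel intertwines the twist**: `κ(zU) = (z·)_* κ(U)`. -/
theorem cmLatOR_centerTwist (l : Edge d L) (e : Fin N ≃ Fin 2 ⊕ m) (U : GaugeConfig d L (Matrix.specialUnitaryGroup (Fin N) ℂ)) :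
    cmLatOR (d := d) (L := L) l e (centerTwist z t₀ U) = (cmLatOR l e U).map (centerTwistEquiv z t₀) := by
  simp only [cmLatOR, Kernel.deterministic_apply]
  rw [Measure.map_dirac' (MeasurableEquiv.measurable _), centerTwistEquiv_apply, siteUpdateMap_cmOR_centerTwist hz]

omit hz [NeZero L] in
/-- The inverse of the centre transformation is the transformation by `z⁻¹`. -/
theorem centerTwistEquiv_symm_apply_eq (z : Matrix.specialUnitaryGroup (Fin N) ℂ)
    (U : GaugeConfig d L (Matrix.specialUnitaryGroup (Fin N) ℂ)) :
    (centerTwistEquiv z t₀).symm U = centerTwist (d := d) (L := L) z⁻¹ t₀ U := by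
  show (twistConfig z t₀)⁻¹ * U = twistConfig z⁻¹ t₀ * U
  congr 1
  funext e
  simp only [twistConfig, Pi.inv_apply, apply_ite Inv.inv, inv_one]

omit hz [NeZero L] in
/-- Twisting by `z⁻¹` and then by `z` is the identity. -/
theorem centerTwist_centerTwist_inv (z : Matrix.specialUnitaryGroup (Fin N) ℂ)
    (V : GaugeConfig d L (Matrix.specialUnitaryGroup (Fin N) ℂ)) : centerTwist z t₀ (centerTwist z⁻¹ t₀ V) = V := by
  funext e; simp only [centerTwist, Pi.mul_apply, twistConfig]; split_ifs <;> simp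

omit hz [NeZero L] in
/-- The same for the measurable equivalences. -/
theorem centerTwistEquiv_comp_inv (z : Matrix.specialUnitaryGroup (Fin N) ℂ) :
    ((centerTwistEquiv (d := d) (L := L) z t₀) ∘ (centerTwistEquiv z⁻¹ t₀)) = id := by
  funext V; simp only [comp_apply, id_eq, centerTwistEquiv_apply, centerTwist_centerTwist_inv]

/-- **`conjKernel (OR hit at l, frame e) (z·) = OR hit at l, frame e`.** -/
theorem conjKernel_cmLatOR_centerTwist (l : Edge d L) (e : Fin N ≃ Fin 2 ⊕ m) :
    conjKernel (cmLatOR (d := d) (L := L) l e) (centerTwistEquiv z t₀) = cmLatOR l e := by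
  refine ProbabilityTheory.Kernel.ext fun U => ?_
  rw [conjKernel_apply, centerTwistEquiv_symm_apply_eq, cmLatOR_centerTwist (Subgroup.inv_mem _ hz),
    Measure.map_map (centerTwistEquiv z t₀).measurable (centerTwistEquiv z⁻¹ t₀).measurable, centerTwistEquiv_comp_inv,
    Measure.map_id]

omit hz [NeZero L] [NeZero d] in
/-- Reporting a cycle of kernels through `F` is the cycle of the reported kernels. -/
private theorem conjKernel_cycle_eq {Ω Ω' : Type*} [MeasurableSpace Ω] [MeasurableSpace Ω'] (F : Ω ≃ᵐ Ω') :
    ∀ ks : List (Kernel Ω Ω), conjKernel (cycle ks) F = cycle (ks.map fun κ => conjKernel κ F)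
  | [] => by rw [cycle_nil, List.map_nil, cycle_nil, conjKernel_id]
  | κ :: ks => by rw [cycle_cons, List.map_cons, cycle_cons, conjKernel_comp, conjKernel_cycle_eq F ks]

/-- **EVERY OR SWEEP, IN ITS GIVEN ORDER, COMMUTES WITH THE TWIST**: `conjKernel (cmORSweep sched) (z·) = cmORSweep sched`. -/
theorem conjKernel_cmORSweep_centerTwist (sched : List (Edge d L × (Fin N ≃ Fin 2 ⊕ m))) :
    conjKernel (cmORSweep (d := d) (L := L) sched) (centerTwistEquiv z t₀) = cmORSweep sched := by
  simp only [cmORSweep, conjKernel_cycle_eq, List.map_map]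
  congr 1
  refine List.map_congr_left fun p _ => ?_
  simp only [comp_apply]
  exact conjKernel_cmLatOR_centerTwist hz t₀ p.1 p.2

end OverRelax

/-! ## §3 The Cabibbo–Marinari heat-bath hit, link update and sweep commute with left multiplication by a central configuration -/

section HeatBath

variable {ι : Type*} [DecidableEq ι] {n : Type*} [Fintype n] [DecidableEq n] {m : Type*} [Fintype m] [DecidableEq m]

/-- The subgroup element placed at link `l` commutes with a central-valued configuration. -/
theorem latFrameHom_mul_central_inv (c : Cfg ι n) (hc : ∀ i, c i ∈ Subgroup.center (Matrix.specialUnitaryGroup n ℂ)) (l : ι)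
    (e : n ≃ Fin 2 ⊕ m) (h : Matrix.specialUnitaryGroup (Fin 2) ℂ) (ω : Cfg ι n) :
    latFrameHom l e h * (c⁻¹ * ω) = c⁻¹ * (latFrameHom l e h * ω) := by
  funext i; simp only [Pi.mul_apply, Pi.inv_apply]
  rw [← mul_assoc, ← mul_assoc, Subgroup.mem_center_iff.1 (Subgroup.inv_mem _ (hc i)) (latFrameHom l e h i)]

/-- **The Cabibbo–Marinari heat-bath hit commutes with left multiplication by a weight-preserving central configuration.** -/
theorem conjKernel_latHit_mulLeft_central (c : Cfg ι n) (hc : ∀ i, c i ∈ Subgroup.center (Matrix.specialUnitaryGroup n ℂ))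
    {p : Cfg ι n → ℝ≥0∞} (hp : Measurable p) (hpc : ∀ ω : Cfg ι n, p (c⁻¹ * ω) = p ω) (l : ι) (e : n ≃ Fin 2 ⊕ m) :
    conjKernel (latHit p l e) (MeasurableEquiv.mulLeft c) = latHit p l e := by
  have hsymm : ∀ ω : Cfg ι n, (MeasurableEquiv.mulLeft c).symm ω = c⁻¹ * ω := fun ω => rfl
  have hZ : ∀ ω, subgroupNorm haarSU2 (latFrameHom l e) p (c⁻¹ * ω) = subgroupNorm haarSU2 (latFrameHom l e) p ω := by
    intro ω
    unfold subgroupNorm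
    refine lintegral_congr fun h => ?_
    rw [latFrameHom_mul_central_inv c hc, hpc]
  have hind : ∀ (B : Set (Cfg ι n)) (y : Cfg ι n),
      (⇑(MeasurableEquiv.mulLeft c) ⁻¹' B).indicator (1 : Cfg ι n → ℝ≥0∞) (c⁻¹ * y) = B.indicator 1 y := fun B y => by
    have hy' : (MeasurableEquiv.mulLeft c) (c⁻¹ * y) = y := by
      show c * (c⁻¹ * y) = y
      rw [← mul_assoc, mul_inv_cancel, one_mul]
    by_cases hy : y ∈ B
    · rw [Set.indicator_of_mem hy, Set.indicator_of_mem (show _ ∈ _ ⁻¹' B by rw [Set.mem_preimage, hy']; exact hy)]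
      rfl
    · rw [Set.indicator_of_notMem hy, Set.indicator_of_notMem (show _ ∉ _ ⁻¹' B by rw [Set.mem_preimage, hy']; exact hy)]
  refine ProbabilityTheory.Kernel.ext fun ω => Measure.ext fun B hB => ?_
  rw [conjKernel_apply' _ _ _ hB, hsymm]
  simp only [latHit]
  rw [subgroupHaarHeatBath_apply _ _ (measurable_latFrameHom l e) hp _ ((MeasurableEquiv.mulLeft c).measurable hB),
    subgroupHaarHeatBath_apply _ _ (measurable_latFrameHom l e) hp _ hB]
  refine lintegral_congr fun h => ?_
  rw [hZ, latFrameHom_mul_central_inv c hc, hpc, hind]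

/-- **The link update (cycle of hits over the frames) commutes with it too.** -/
theorem conjKernel_latLink_mulLeft_central (c : Cfg ι n) (hc : ∀ i, c i ∈ Subgroup.center (Matrix.specialUnitaryGroup n ℂ))
    {p : Cfg ι n → ℝ≥0∞} (hp : Measurable p) (hpc : ∀ ω : Cfg ι n, p (c⁻¹ * ω) = p ω) (frames : List (n ≃ Fin 2 ⊕ m)) (l : ι) :
    conjKernel (latLink p frames l) (MeasurableEquiv.mulLeft c) = latLink p frames l := by
  simp only [latLink, conjKernel_cycle_eq, List.map_map]
  congr 1
  refine List.map_congr_left fun e _ => ?_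
  simp only [comp_apply]
  exact conjKernel_latHit_mulLeft_central c hc hp hpc l e

/-- **THE HEAT-BATH SWEEP, IN ITS GIVEN ORDER, COMMUTES WITH LEFT MULTIPLICATION BY A WEIGHT-PRESERVING CENTRAL CONFIGURATION.** -/
theorem conjKernel_latSweep_mulLeft_central (c : Cfg ι n) (hc : ∀ i, c i ∈ Subgroup.center (Matrix.specialUnitaryGroup n ℂ))
    {p : Cfg ι n → ℝ≥0∞} (hp : Measurable p) (hpc : ∀ ω : Cfg ι n, p (c⁻¹ * ω) = p ω) (frames : List (n ≃ Fin 2 ⊕ m))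
    (links : List ι) :
    conjKernel (latSweep p frames links) (MeasurableEquiv.mulLeft c) = latSweep p frames links := by
  simp only [latSweep, conjKernel_cycle_eq, List.map_map]
  congr 1
  refine List.map_congr_left fun l _ => ?_
  simp only [comp_apply]
  exact conjKernel_latLink_mulLeft_central c hc hp hpc frames l

end HeatBath

/-! ## §4 Row 21's E1 composite is centre symmetric; `E_n[tr P] = 0` at every sweep from a hot start -/

section Composite

variable {d L N : ℕ} [NeZero d] [NeZero L] {m : Type*} [Fintype m] [DecidableEq m]
  {z : Matrix.specialUnitaryGroup (Fin N) ℂ} (hz : z ∈ Subgroup.center (Matrix.specialUnitaryGroup (Fin N) ℂ)) (t₀ : ZMod L)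
include hz

/-- The Wilson weight `e^{−βS_W}` is blind to the inverse twist of its argument (Literature `wilsonAction_centerTwist`). -/
theorem gibbsDensity_wilson_centerTwist_inv (β : ℝ) (ω : GaugeConfig d L (Matrix.specialUnitaryGroup (Fin N) ℂ)) :
    gibbsDensity (fun U : GaugeConfig d L (Matrix.specialUnitaryGroup (Fin N) ℂ) => β * wilsonAction (suRep N) U)
        ((twistConfig z t₀)⁻¹ * ω) =
      gibbsDensity (fun U : GaugeConfig d L (Matrix.specialUnitaryGroup (Fin N) ℂ) => β * wilsonAction (suRep N) U) ω := by
  have h : (twistConfig (d := d) (L := L) z t₀)⁻¹ * ω = centerTwist z⁻¹ t₀ ω := by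
    rw [← centerTwistEquiv_symm_apply_eq]
    rfl
  rw [h]
  simp only [gibbsDensity, wilsonAction_centerTwist (suRep N) (Subgroup.inv_mem _ hz)]

/-- **ROW 21's E1 COMPOSITE (`'hb' + n_or × 'or'`) COMMUTES WITH THE CENTRE TRANSFORMATION**, for the Wilson weight at every `β`,
every frame list, link order and OR schedule: `conjKernel (cmORSweep sched ∘ₖ HB sweep) (z·) = cmORSweep sched ∘ₖ HB sweep`. -/
theorem conjKernel_cmHeatBath_orSweep_centerTwist (β : ℝ) (frames : List (Fin N ≃ Fin 2 ⊕ m)) (links : List (Edge d L))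
    (sched : List (Edge d L × (Fin N ≃ Fin 2 ⊕ m))) :
    conjKernel (cmORSweep (d := d) (L := L) sched ∘ₖ
        latSweep (gibbsDensity fun U : GaugeConfig d L (Matrix.specialUnitaryGroup (Fin N) ℂ) => β * wilsonAction (suRep N) U)
          frames links) (centerTwistEquiv z t₀) =
      cmORSweep sched ∘ₖ
        latSweep (gibbsDensity fun U : GaugeConfig d L (Matrix.specialUnitaryGroup (Fin N) ℂ) => β * wilsonAction (suRep N) U)
          frames links := by
  rw [conjKernel_comp, conjKernel_cmORSweep_centerTwist hz]
  congr 1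
  exact conjKernel_latSweep_mulLeft_central (twistConfig z t₀) (fun i => twistConfig_mem_center hz t₀ i)
    (measurable_gibbsDensity (continuous_smul_wilsonAction (suRep N) continuous_suRep β))
    (gibbsDensity_wilson_centerTwist_inv hz t₀ β) frames links

/-- **The order-parameter mechanism along the E1 chain**: from a twist-invariant start the `n`-sweep law is twist invariant, so
`F(zU) = ω F(U)`, `ω ≠ 1` ⇒ `E_n[F] = 0` at every `n` (no integrability needed). -/
theorem integral_e1Chain_eq_zero_of_centerCovariant (β : ℝ) (frames : List (Fin N ≃ Fin 2 ⊕ m)) (links : List (Edge d L))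
    (sched : List (Edge d L × (Fin N ≃ Fin 2 ⊕ m))) {μ₀ : Measure (GaugeConfig d L (Matrix.specialUnitaryGroup (Fin N) ℂ))}
    (hμ₀ : μ₀.map (centerTwistEquiv z t₀) = μ₀) (nsw : ℕ) (F : GaugeConfig d L (Matrix.specialUnitaryGroup (Fin N) ℂ) → ℂ)
    {ω : ℂ} (hω : ω ≠ 1) (hF : ∀ U, F (centerTwist z t₀ U) = ω * F U) :
    ∫ U, F U ∂(μ₀.bind (nHit (cmORSweep (d := d) (L := L) sched ∘ₖ
        latSweep (gibbsDensity fun U : GaugeConfig d L (Matrix.specialUnitaryGroup (Fin N) ℂ) => β * wilsonAction (suRep N) U)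
          frames links) nsw)) = 0 :=
  integral_eq_zero_of_covariant (centerTwistEquiv z t₀)
    (Scoring.map_bind_nHit_eq_self (conjKernel_cmHeatBath_orSweep_centerTwist hz t₀ β frames links sched) hμ₀ nsw) F hω hF

omit hz

/-- **HOT START: `E_n[tr P(y)] = 0` AT EVERY SWEEP `n`** of the E1 chain (`SU(N)`, `N ≥ 2`; every `β`, volume, base site, frame
list, link order, OR schedule): `∏ dHaar` is twist invariant and `tr P` is centre covariant with a phase `ω ≠ 1`. -/
theorem integral_e1HotStart_tracePolyakov_eq_zero (hN : 2 ≤ N) (β : ℝ) (frames : List (Fin N ≃ Fin 2 ⊕ m))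
    (links : List (Edge d L)) (sched : List (Edge d L × (Fin N ≃ Fin 2 ⊕ m))) (nsw : ℕ) (y : Site d L) :
    ∫ U, tracePolyakov N y U ∂((Measure.pi fun _ : Edge d L => haarProbability (Matrix.specialUnitaryGroup (Fin N) ℂ)).bind
        (nHit (cmORSweep (d := d) (L := L) sched ∘ₖ
          latSweep (gibbsDensity fun U : GaugeConfig d L (Matrix.specialUnitaryGroup (Fin N) ℂ) => β * wilsonAction (suRep N) U)
            frames links) nsw)) = 0 := by
  obtain ⟨z, ω, hz, hω, hF⟩ := isCenterCovariant_tracePolyakov (d := d) (L := L) hN y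
  exact integral_e1Chain_eq_zero_of_centerCovariant hz 0 β frames links sched (map_centerTwist_pi_haar z 0) nsw
    (tracePolyakov N y) hω (hF 0)

end Composite

/-! ## §5 The open-boundary heat-bath sweep (arm `OBC`, local update) is centre symmetric too -/

section OpenBoundary

variable {d L N M : ℕ} [NeZero d] [NeZero L] {m : Type*} [Fintype m] [DecidableEq m]
  (ρ : Matrix.specialUnitaryGroup (Fin N) ℂ →* Matrix (Fin M) (Fin M) ℂ)
  {z : Matrix.specialUnitaryGroup (Fin N) ℂ} (hz : z ∈ Subgroup.center (Matrix.specialUnitaryGroup (Fin N) ℂ)) (t₀ : ZMod L)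
include hz

/-- The open-boundary weight `e^{−β S_OBC}` is blind to the inverse twist (the twist changes no plaquette). -/
theorem gibbsDensity_obc_centerTwist_inv (τ : Fin d) (β : ℝ) (ω : GaugeConfig d L (Matrix.specialUnitaryGroup (Fin N) ℂ)) :
    gibbsDensity (fun U : GaugeConfig d L (Matrix.specialUnitaryGroup (Fin N) ℂ) => β * obcAction ρ τ U)
        ((twistConfig z t₀)⁻¹ * ω) =
      gibbsDensity (fun U : GaugeConfig d L (Matrix.specialUnitaryGroup (Fin N) ℂ) => β * obcAction ρ τ U) ω := by
  have h : (twistConfig (d := d) (L := L) z t₀)⁻¹ * ω = centerTwist z⁻¹ t₀ ω := by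
    rw [← centerTwistEquiv_symm_apply_eq]
    rfl
  rw [h]
  simp only [gibbsDensity, obcAction, weightedWilsonAction, plaquetteHolonomy_centerTwist (Subgroup.inv_mem _ hz)]

/-- **THE OPEN-BOUNDARY HEAT-BATH SWEEP (`OpenBoundaryCMSweep`'s kernel) COMMUTES WITH THE CENTRE TRANSFORMATION.** -/
theorem conjKernel_obcSweep_centerTwist (hρ : Continuous ρ) (τ : Fin d) (β : ℝ) (frames : List (Fin N ≃ Fin 2 ⊕ m))
    (links : List (Edge d L)) :
    conjKernel (latSweep (gibbsDensity fun U : GaugeConfig d L (Matrix.specialUnitaryGroup (Fin N) ℂ) => β * obcAction ρ τ U)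
        frames links) (centerTwistEquiv z t₀) =
      latSweep (gibbsDensity fun U : GaugeConfig d L (Matrix.specialUnitaryGroup (Fin N) ℂ) => β * obcAction ρ τ U)
        frames links :=
  conjKernel_latSweep_mulLeft_central (twistConfig z t₀) (fun i => twistConfig_mem_center hz t₀ i)
    (measurable_gibbsDensity (continuous_const.mul (continuous_obcAction ρ hρ τ))) (gibbsDensity_obc_centerTwist_inv ρ hz t₀ τ β)
    frames links

/-- The order-parameter mechanism along the open-boundary heat-bath chain, from any twist-invariant start. -/
theorem integral_obcSweepChain_eq_zero_of_centerCovariant (hρ : Continuous ρ) (τ : Fin d) (β : ℝ)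
    (frames : List (Fin N ≃ Fin 2 ⊕ m)) (links : List (Edge d L))
    {μ₀ : Measure (GaugeConfig d L (Matrix.specialUnitaryGroup (Fin N) ℂ))} (hμ₀ : μ₀.map (centerTwistEquiv z t₀) = μ₀) (nsw : ℕ)
    (F : GaugeConfig d L (Matrix.specialUnitaryGroup (Fin N) ℂ) → ℂ) {ω : ℂ} (hω : ω ≠ 1) (hF : ∀ U, F (centerTwist z t₀ U) = ω * F U) :
    ∫ U, F U ∂(μ₀.bind (nHit (latSweep
        (gibbsDensity fun U : GaugeConfig d L (Matrix.specialUnitaryGroup (Fin N) ℂ) => β * obcAction ρ τ U) frames links) nsw)) = 0 :=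
  integral_eq_zero_of_covariant (centerTwistEquiv z t₀)
    (Scoring.map_bind_nHit_eq_self (conjKernel_obcSweep_centerTwist ρ hz t₀ hρ τ β frames links) hμ₀ nsw) F hω hF

omit hz

/-- **HOT START, OPEN BOUNDARY: `E_n[tr P(y)] = 0` AT EVERY SWEEP** of the open-boundary heat-bath chain (`SU(N)`, `N ≥ 2`, every `τ`). -/
theorem integral_obcSweepHotStart_tracePolyakov_eq_zero (hN : 2 ≤ N) (τ : Fin d) (β : ℝ) (frames : List (Fin N ≃ Fin 2 ⊕ m))
    (links : List (Edge d L)) (nsw : ℕ) (y : Site d L) :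
    ∫ U, tracePolyakov N y U ∂((Measure.pi fun _ : Edge d L => haarProbability (Matrix.specialUnitaryGroup (Fin N) ℂ)).bind
        (nHit (latSweep (gibbsDensity fun U : GaugeConfig d L (Matrix.specialUnitaryGroup (Fin N) ℂ) =>
          β * obcAction (suRep N) τ U) frames links) nsw)) = 0 := by
  obtain ⟨z, ω, hz, hω, hF⟩ := isCenterCovariant_tracePolyakov (d := d) (L := L) hN y
  exact integral_obcSweepChain_eq_zero_of_centerCovariant (suRep N) hz 0 continuous_suRep τ β frames links
    (map_centerTwist_pi_haar z 0) nsw (tracePolyakov N y) hω (hF 0)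

end OpenBoundary

end Summit.Ventures.LatticeQCDFlow.Exactness
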